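import Literature.NumberTheory.LFunctions.FiniteLSeries
import HarnessLib

/-!
# Uniform two-sided bounds for finitely many Dirichlet polynomials on vertical segments

Topic `Literature/NumberTheory/LFunctions` (namespace `Literature.NumberTheory.LFunctions`,
sub-namespace `SaiasWeingartner`). Everything here is PROVED.

In the proof of Saias–Weingartner 2009, Theorem 2 (case `σ₁ ≥ 1`, arXiv:0807.0783 p. 7–8) the
rational functions `hⱼ(p₁^{-s}, …, p_L^{-s})` — here the Dirichlet polynomials `Pⱼ` shifted by
`it` — are frozen at phases where they have "neither zeros nor poles for `1 ≤ σ ≤ 2`", and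
`c := min_j min_{1 ≤ σ ≤ 2} |hⱼ|`, `C := max_j max |hⱼ|` enter the radius `R̃ = max(C/R, R/c)`
handed to Lemma 2, which must not depend on `σ`. We prove the form of this that the
formalisation uses:

* `exists_forall_LSeries_ne_zero_near` — around any point, a punctured disc on which none of
  finitely many non-zero Dirichlet polynomials vanishes (isolated zeros of entire functions);
* `exists_uniform_bounds_LSeries_shift` — there are `0 < c ≤ C` such that for every `σ ∈ [1, 2]`
  some real `t` has `c ≤ |Pⱼ(σ + it)| ≤ C` for all `j` (pointwise non-vanishing at some `σ + it₀`
  near `σ`, continuity in `σ`, and a finite subcover of the compact interval `[1, 2]`).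

## References

* [SaiasWeingartner2009] E. Saias, A. Weingartner, *Zeros of Dirichlet series with periodic
  coefficients*, Acta Arith. 140 (2009), 335–344, proof of Lemma 2 (general `h`) and §4 (read).
-/

noncomputable section

open Complex Filter Topology Metric Set

namespace Literature.NumberTheory.LFunctions

namespace SaiasWeingartner

/-- **A punctured disc free of zeros of finitely many non-zero Dirichlet polynomials**: around
any point `z₀` there is `ε > 0` such that no `LSeries (P i)` vanishes at the points `z ≠ z₀` with
`|z − z₀| < ε` (each is entire and not identically zero, hence has isolated zeros). [folklore] -/
theorem exists_forall_LSeries_ne_zero_near {ι : Type*} [Finite ι] {P : ι → ℕ → ℂ}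
    (hfin : ∀ i, (Function.support (P i)).Finite) (hne : ∀ i, ∃ n, n ≠ 0 ∧ P i n ≠ 0) (z₀ : ℂ) :
    ∃ ε : ℝ, 0 < ε ∧ ∀ z : ℂ, z ≠ z₀ → dist z z₀ < ε → ∀ i, LSeries (P i) z ≠ 0 := by
  have h : ∀ i, ∀ᶠ z in 𝓝[≠] z₀, LSeries (P i) z ≠ 0 := by
    intro i
    rcases (FiniteLSeries.analyticAt (hfin i) z₀).eventually_eq_zero_or_eventually_ne_zero with
      h | h
    · exfalso
      have hU : AnalyticOnNhd ℂ (LSeries (P i)) univ :=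
        fun z _ ↦ FiniteLSeries.analyticAt (hfin i) z
      have h0 := hU.eqOn_zero_of_preconnected_of_eventuallyEq_zero isPreconnected_univ
        (mem_univ z₀) h
      exact FiniteLSeries.ne_zero (hfin i) (hne i) (funext fun z ↦ h0 (mem_univ z))
    · exact h
  have hall : ∀ᶠ z in 𝓝[≠] z₀, ∀ i, LSeries (P i) z ≠ 0 := eventually_all.2 h
  obtain ⟨ε, hε, hball⟩ := Metric.eventually_nhds_iff_ball.1 (eventually_nhdsWithin_iff.1 hall)
  exact ⟨ε, hε, fun z hz hzd i ↦ hball z (mem_ball.2 hzd) hz i⟩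

/-- **Uniform two-sided bounds on vertical shifts.** For finitely many non-zero Dirichlet
polynomials `Pⱼ` there are `0 < c ≤ C` such that for every `σ ∈ [1, 2]` some real `t` satisfies
`c ≤ |Pⱼ(σ + it)| ≤ C` for all `j` (the constants `c, C` of the proof of Lemma 2 of the source,
uniform in `σ` by compactness of `[1, 2]`). [cite: SaiasWeingartner2009, Lemma 2 (proof)] -/
theorem exists_uniform_bounds_LSeries_shift {ι : Type*} [Fintype ι] {P : ι → ℕ → ℂ}
    (hfin : ∀ i, (Function.support (P i)).Finite) (hne : ∀ i, ∃ n, n ≠ 0 ∧ P i n ≠ 0) :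
    ∃ c C : ℝ, 0 < c ∧ c ≤ C ∧ ∀ σ : ℝ, σ ∈ Icc (1 : ℝ) 2 →
      ∃ t : ℝ, ∀ i, c ≤ ‖LSeries (P i) ((σ : ℂ) + t * I)‖ ∧
        ‖LSeries (P i) ((σ : ℂ) + t * I)‖ ≤ C := by
  classical
  -- upper bound
  set C : ℝ := (∑ i, ∑ n ∈ (hfin i).toFinset, ‖P i n‖) + 1 with hC
  have hCle : ∀ i, ∀ z : ℂ, 0 ≤ z.re → ‖LSeries (P i) z‖ ≤ C := fun i z hz ↦
    ((FiniteLSeries.norm_le (hfin i) hz).trans (Finset.single_le_sum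
      (f := fun i ↦ ∑ n ∈ (hfin i).toFinset, ‖P i n‖)
      (fun i _ ↦ Finset.sum_nonneg fun n _ ↦ norm_nonneg _) (Finset.mem_univ i))).trans
      (by rw [hC]; linarith)
  -- pointwise: for each `σ₀` a shift `t₀` and a margin `m > 0`, valid near `σ₀`
  have hpt : ∀ σ₀ : ℝ, ∃ tm : ℝ × ℝ, 0 < tm.2 ∧
      ∀ᶠ σ : ℝ in 𝓝 σ₀, ∀ i, tm.2 < ‖LSeries (P i) ((σ : ℂ) + tm.1 * I)‖ := by
    intro σ₀
    obtain ⟨ε, hε, hD⟩ := exists_forall_LSeries_ne_zero_near hfin hne (σ₀ : ℂ)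
    set t₀ : ℝ := ε / 2 with ht₀
    have hz : ∀ i, LSeries (P i) ((σ₀ : ℂ) + t₀ * I) ≠ 0 := by
      refine hD _ ?_ ?_
      · intro h
        have := congrArg Complex.im h
        simp [ht₀] at this
        linarith
      · rw [dist_eq_norm, add_sub_cancel_left, norm_mul, norm_I, mul_one, norm_real,
          Real.norm_eq_abs, abs_of_pos (by positivity)]
        linarith
    rcases isEmpty_or_nonempty ι with hι | hι
    · exact ⟨(t₀, 1), one_pos, Eventually.of_forall fun σ i ↦ (hι.false i).elim⟩
    set m : ℝ := (Finset.univ.inf' Finset.univ_nonempty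
      fun i ↦ ‖LSeries (P i) ((σ₀ : ℂ) + t₀ * I)‖) / 2 with hm
    have hm0 : 0 < m := by
      rw [hm]
      refine half_pos ((Finset.lt_inf'_iff _).2 fun i _ ↦ norm_pos_iff.2 (hz i))
    have hmlt : ∀ i, m < ‖LSeries (P i) ((σ₀ : ℂ) + t₀ * I)‖ := by
      intro i
      have h1 : 2 * m ≤ ‖LSeries (P i) ((σ₀ : ℂ) + t₀ * I)‖ := by
        rw [hm, mul_div_cancel₀ _ two_ne_zero]
        exact Finset.inf'_le _ (Finset.mem_univ i)
      linarith
    refine ⟨(t₀, m), hm0, ?_⟩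
    have hcont : ∀ i, Continuous fun σ : ℝ ↦ ‖LSeries (P i) ((σ : ℂ) + t₀ * I)‖ := fun i ↦
      ((FiniteLSeries.continuous (hfin i)).comp (by fun_prop)).norm
    have : ∀ i, ∀ᶠ σ : ℝ in 𝓝 σ₀, m < ‖LSeries (P i) ((σ : ℂ) + t₀ * I)‖ := fun i ↦
      (hcont i).continuousAt.eventually_const_lt (hmlt i)
    exact eventually_all.2 this
  choose tm htm0 htm using hpt
  -- finite subcover of `[1, 2]`
  set U : ℝ → Set ℝ := fun σ₀ ↦
    {σ : ℝ | ∀ i, (tm σ₀).2 < ‖LSeries (P i) ((σ : ℂ) + (tm σ₀).1 * I)‖} with hU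
  have hUn : ∀ σ₀ ∈ Icc (1 : ℝ) 2, U σ₀ ∈ 𝓝 σ₀ := fun σ₀ _ ↦ htm σ₀
  obtain ⟨T, -, hcover⟩ := (isCompact_Icc (a := (1 : ℝ)) (b := 2)).elim_nhds_subcover U hUn
  have hTne : T.Nonempty := by
    by_contra h
    rw [Finset.not_nonempty_iff_eq_empty] at h
    have := hcover (show (1 : ℝ) ∈ Icc (1 : ℝ) 2 from ⟨le_rfl, one_le_two⟩)
    simp [h] at this
  set c : ℝ := min (T.inf' hTne fun σ₀ ↦ (tm σ₀).2) C with hc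
  have hc0 : 0 < c := lt_min ((Finset.lt_inf'_iff _).2 fun σ₀ _ ↦ htm0 σ₀) (by
    rw [hC]; exact add_pos_of_nonneg_of_pos (Finset.sum_nonneg fun i _ ↦
      Finset.sum_nonneg fun n _ ↦ norm_nonneg _) one_pos)
  refine ⟨c, C, hc0, min_le_right _ _, fun σ hσ ↦ ?_⟩
  obtain ⟨σ₀, hσ₀T, hσU⟩ : ∃ σ₀ ∈ T, σ ∈ U σ₀ := by
    simpa only [mem_iUnion, exists_prop] using hcover hσ
  refine ⟨(tm σ₀).1, fun i ↦ ⟨?_, hCle i _ (by simp; linarith [hσ.1])⟩⟩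
  calc c ≤ T.inf' hTne (fun σ₀ ↦ (tm σ₀).2) := min_le_left _ _
    _ ≤ (tm σ₀).2 := Finset.inf'_le _ hσ₀T
    _ ≤ _ := (hσU i).le

end SaiasWeingartner

end Literature.NumberTheory.LFunctions
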